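import Mathlib
import Summits.MatrixMultiplication.MatrixMultiplication.Theorems.SnSubsetDichotomyHyperoctahedralThresholdTwinSupplyCSCyclic

/-!
# Most roots are `F`-typical: the Markov numerator (crux `HyperoctahedralThreshold`, line `stub_poorRigidCore`, plan T1)

Conventions of the line: three involutions `μ d` of `Fin n` act on the right, `y · β := β.foldl (fun w d => μ d w) y`;
reduced words are `List.IsChain (· ≠ ·)`; the reduced words of length `a` form `TwinSupplyCS.RW a`
(`|RW a| = 3 · 2^(a-1)` for `a ≥ 1`, `RW 0 = {[]}`).  A root is an ordered pair `(v, x)` of points; its two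
trajectories along a word `β` are `t ↦ v · β_[t]` and `t ↦ x · β_[t]` (`β_[t] = β.take t`, `t ≤ a`).

* `stub_rootTypicalSum` (registered sub-goal of stmt-MatrixMultiplication-10883): summed over ALL ordered roots
  `(v, x)`, the reduced words `β` of length `a` one of whose two trajectories meets a forbidden set `F` number at most
  `2 (a + 1) · |F| · n · (3 · 2^a)`.

Proof (bijection trick): a bad triple `(v, x, β)` has a time `t ≤ a` with `v · β_[t] ∈ F` or `x · β_[t] ∈ F`; for fixed
`β` and `t` the map `y ↦ y · β_[t]` is injective (a composite of permutations), so `#{y : y · β_[t] ∈ F} ≤ |F|`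
(`sum_card_filter_mem_le`); a union bound over `t ≤ a` and the two sides gives `≤ 2 n (a + 1) |RW a| |F|`, and
`|RW a| ≤ 3 · 2^a` (`card_RW_le`).  Pure finite combinatorics; no definitions.
-/

-- the tree's namespace `Summit.MatrixMultiplication.MatrixMultiplication.…` repeats a component by design
set_option linter.dupNamespace false

namespace Summit.MatrixMultiplication.MatrixMultiplication.Theorems.HyperoctahedralThreshold

namespace RootTypicalSum

open Finset TwinSupplyCS

variable {n : ℕ}

-- adapted from Summits/MatrixMultiplication/MatrixMultiplication/Theorems/
--   SnSubsetDichotomyHyperoctahedralThresholdStubSameColourStructureWalk.lean (`StructureWalk.foldl_act_injective`)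
/-- A colour word acts injectively (it acts by a composite of the permutations `μ d`). -/
theorem foldl_injective (μ : Fin 3 → Equiv.Perm (Fin n)) (w : List (Fin 3)) :
    Function.Injective fun y : Fin n => w.foldl (fun v d => μ d v) y := by
  induction w with
  | nil => exact fun a b h => h
  | cons c w ih =>
    intro a b h
    simp only [List.foldl_cons] at h
    exact (μ c).injective (ih h)

/-- The bijection trick: if every `f β` is injective then
`∑_y #{β ∈ W : f β y ∈ F} = ∑_{β ∈ W} #{y : f β y ∈ F} ≤ |W| · |F|`. -/
theorem sum_card_filter_mem_le (W : Finset (List (Fin 3))) (f : List (Fin 3) → Fin n → Fin n)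
    (hf : ∀ β, Function.Injective (f β)) (F : Finset (Fin n)) :
    ∑ y : Fin n, (W.filter fun β => f β y ∈ F).card ≤ W.card * F.card := by
  calc ∑ y : Fin n, (W.filter fun β => f β y ∈ F).card
      = ∑ y : Fin n, ∑ β ∈ W, (if f β y ∈ F then 1 else 0) := by simp_rw [Finset.card_filter]
    _ = ∑ β ∈ W, ∑ y : Fin n, (if f β y ∈ F then 1 else 0) := Finset.sum_comm
    _ = ∑ β ∈ W, ((Finset.univ : Finset (Fin n)).filter fun y => f β y ∈ F).card := by
        simp_rw [Finset.card_filter]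
    _ ≤ ∑ β ∈ W, F.card := by
        refine Finset.sum_le_sum fun β _ => ?_
        refine Finset.card_le_card_of_injOn (f β) ?_ ?_
        · intro y hy
          rw [Finset.mem_coe, Finset.mem_filter] at hy
          exact hy.2
        · intro y _ y' _ h
          exact hf β h
    _ = W.card * F.card := by rw [Finset.sum_const, smul_eq_mul]

/-- Summed over the root point `y` and the time `t ≤ a`, the reduced words `β` of length `a` with `y · β_[t] ∈ F`
number at most `(a + 1) · |RW a| · |F|`. -/
theorem sum_sum_card_le (μ : Fin 3 → Equiv.Perm (Fin n)) (F : Finset (Fin n)) (a : ℕ) :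
    ∑ y : Fin n, ∑ t ∈ Finset.range (a + 1),
        ((RW a).filter fun β => (β.take t).foldl (fun w d => μ d w) y ∈ F).card ≤
      (a + 1) * ((RW a).card * F.card) := by
  rw [Finset.sum_comm]
  calc ∑ t ∈ Finset.range (a + 1), ∑ y : Fin n,
        ((RW a).filter fun β => (β.take t).foldl (fun w d => μ d w) y ∈ F).card
      ≤ ∑ t ∈ Finset.range (a + 1), (RW a).card * F.card :=
        Finset.sum_le_sum fun t _ => sum_card_filter_mem_le (RW a)
          (fun β y => (β.take t).foldl (fun w d => μ d w) y) (fun β => foldl_injective μ (β.take t)) F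
    _ = (a + 1) * ((RW a).card * F.card) := by
        rw [Finset.sum_const, Finset.card_range, smul_eq_mul]

/-- `|RW a| ≤ 3 · 2^a` (a crude form of `card_RW`, valid also for `a = 0`). -/
theorem card_RW_le (a : ℕ) : (RW a).card ≤ 3 * 2 ^ a := by
  rcases Nat.eq_zero_or_pos a with rfl | ha
  · rw [RW_zero, Finset.card_singleton]
    norm_num
  · rw [card_RW ha]
    exact Nat.mul_le_mul_left 3 (Nat.pow_le_pow_right (by norm_num) (Nat.sub_le a 1))

/-- Double-counting a one-variable weight over ordered pairs: `∑_v ∑_x (g v + g x) = 2 n ∑_y g y`. -/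
theorem sum_sum_add (g : Fin n → ℕ) : ∑ v : Fin n, ∑ x : Fin n, (g v + g x) = 2 * n * ∑ y : Fin n, g y := by
  simp only [Finset.sum_add_distrib, Finset.sum_const, Finset.card_univ, Fintype.card_fin, smul_eq_mul,
    ← Finset.mul_sum]
  ring

/-- Union bound at one root `(v, x)`: a reduced word one of whose two trajectories meets `F` does so at some time
`t ≤ a` on the `v`-side or on the `x`-side. -/
theorem card_bad_le (μ : Fin 3 → Equiv.Perm (Fin n)) (F : Finset (Fin n)) (a : ℕ) (v x : Fin n) :
    (((Finset.univ : Finset (List.Vector (Fin 3) a)).image List.Vector.toList).filter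
        (fun β => List.IsChain (· ≠ ·) β ∧ ¬ (∀ t ≤ a, (β.take t).foldl (fun w d => μ d w) v ∉ F ∧
          (β.take t).foldl (fun w d => μ d w) x ∉ F))).card ≤
      ∑ t ∈ Finset.range (a + 1), ((RW a).filter fun β => (β.take t).foldl (fun w d => μ d w) v ∈ F).card +
        ∑ t ∈ Finset.range (a + 1), ((RW a).filter fun β => (β.take t).foldl (fun w d => μ d w) x ∈ F).card := by
  rw [← Finset.sum_add_distrib]
  calc (((Finset.univ : Finset (List.Vector (Fin 3) a)).image List.Vector.toList).filter
        (fun β => List.IsChain (· ≠ ·) β ∧ ¬ (∀ t ≤ a, (β.take t).foldl (fun w d => μ d w) v ∉ F ∧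
          (β.take t).foldl (fun w d => μ d w) x ∉ F))).card
      ≤ ((Finset.range (a + 1)).biUnion fun t =>
          ((RW a).filter fun β => (β.take t).foldl (fun w d => μ d w) v ∈ F) ∪
            ((RW a).filter fun β => (β.take t).foldl (fun w d => μ d w) x ∈ F)).card := by
        refine Finset.card_le_card ?_
        intro β hβ
        rw [Finset.mem_filter, Finset.mem_image] at hβ
        obtain ⟨⟨w, -, rfl⟩, hc, hbad⟩ := hβ
        have hW : w.toList ∈ RW a := mem_RW.2 ⟨w.toList_length, hc⟩
        push Not at hbad
        obtain ⟨t, hta, ht⟩ := hbad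
        rw [Finset.mem_biUnion]
        refine ⟨t, Finset.mem_range.2 (Nat.lt_succ_of_le hta), ?_⟩
        rw [Finset.mem_union, Finset.mem_filter, Finset.mem_filter]
        by_cases hv : (w.toList.take t).foldl (fun w d => μ d w) v ∈ F
        · exact Or.inl ⟨hW, hv⟩
        · exact Or.inr ⟨hW, ht hv⟩
    _ ≤ ∑ t ∈ Finset.range (a + 1),
          (((RW a).filter fun β => (β.take t).foldl (fun w d => μ d w) v ∈ F) ∪
            ((RW a).filter fun β => (β.take t).foldl (fun w d => μ d w) x ∈ F)).card :=
        Finset.card_biUnion_le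
    _ ≤ ∑ t ∈ Finset.range (a + 1),
          (((RW a).filter fun β => (β.take t).foldl (fun w d => μ d w) v ∈ F).card +
            ((RW a).filter fun β => (β.take t).foldl (fun w d => μ d w) x ∈ F).card) :=
        Finset.sum_le_sum fun t _ => Finset.card_union_le _ _

end RootTypicalSum

open Finset TwinSupplyCS in
/-- **`stub_rootTypicalSum`** (registered sub-goal of stmt-MatrixMultiplication-10883, plan T1 of line
`stub_poorRigidCore`): the Markov numerator for "most roots are `F`-typical" — summed over all ordered roots `(v, x)`,
the reduced words of length `a` one of whose two trajectories `t ↦ v · β_[t]`, `t ↦ x · β_[t]` (`t ≤ a`) meets `F`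
number at most `2 (a + 1) · |F| · n · (3 · 2^a)`.  The involution hypothesis is not used. -/
theorem stub_rootTypicalSum : ∀ (n a : ℕ) (μ : Fin 3 → Equiv.Perm (Fin n)) (F : Finset (Fin n)), (∀ b, μ b * μ b = 1) → ∑ v : Fin n, ∑ x : Fin n, (((Finset.univ : Finset (List.Vector (Fin 3) a)).image List.Vector.toList).filter (fun β => List.IsChain (· ≠ ·) β ∧ ¬ (∀ t ≤ a, (β.take t).foldl (fun w d => μ d w) v ∉ F ∧ (β.take t).foldl (fun w d => μ d w) x ∉ F))).card ≤ 2 * (a + 1) * F.card * n * (3 * 2 ^ a) := by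
  intro n a μ F _
  calc ∑ v : Fin n, ∑ x : Fin n, (((Finset.univ : Finset (List.Vector (Fin 3) a)).image List.Vector.toList).filter
          (fun β => List.IsChain (· ≠ ·) β ∧ ¬ (∀ t ≤ a, (β.take t).foldl (fun w d => μ d w) v ∉ F ∧
            (β.take t).foldl (fun w d => μ d w) x ∉ F))).card
      ≤ ∑ v : Fin n, ∑ x : Fin n,
          (∑ t ∈ Finset.range (a + 1),
              ((RW a).filter fun β => (β.take t).foldl (fun w d => μ d w) v ∈ F).card +
            ∑ t ∈ Finset.range (a + 1),
              ((RW a).filter fun β => (β.take t).foldl (fun w d => μ d w) x ∈ F).card) :=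
        Finset.sum_le_sum fun v _ => Finset.sum_le_sum fun x _ => RootTypicalSum.card_bad_le μ F a v x
    _ = 2 * n * ∑ y : Fin n, ∑ t ∈ Finset.range (a + 1),
          ((RW a).filter fun β => (β.take t).foldl (fun w d => μ d w) y ∈ F).card :=
        RootTypicalSum.sum_sum_add _
    _ ≤ 2 * n * ((a + 1) * ((RW a).card * F.card)) :=
        Nat.mul_le_mul_left _ (RootTypicalSum.sum_sum_card_le μ F a)
    _ ≤ 2 * n * ((a + 1) * ((3 * 2 ^ a) * F.card)) :=
        Nat.mul_le_mul_left _ (Nat.mul_le_mul_left _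
          (Nat.mul_le_mul_right _ (RootTypicalSum.card_RW_le a)))
    _ = 2 * (a + 1) * F.card * n * (3 * 2 ^ a) := by ring

end Summit.MatrixMultiplication.MatrixMultiplication.Theorems.HyperoctahedralThreshold
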